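import Summits.QuantumFields.YangMills.Theorems.BalabanUVNodesN15TwoGridHolder
import Summits.QuantumFields.YangMills.Theorems.BalabanUVNodesN15TwoGridEntries
import HarnessLib

/-!
# Route «BalabanUVNodes», node N15 = NE2, -a lane, part 43: DOOR (iv) R3, LAPLACIAN PART — THE TWO-GRID DEFECT `G′∘(Δ′P̂₂ − P̂₂Δ)∘G` OF BAŁABAN's
# PROPAGATORS IS `O(η^α)` AS A BLOCK MAJORANT (`C·(L^k)^{−α}·e^{−δ|y−y′|_T}`), HYPOTHESIS-FREE ON THE TORUS FAMILY OF RECORD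

Cell `pub-ymgap`, seat `pub-ymgap-dag-n15-a` (KNIT-BY-NAME, g11); `--supports stmt-QuantumFields-19910 --as helper`; `HOME/pub-ymgap-dag-n15-a/DOOR-IV-PLAN.md` §7.1–§7.2 (route R,
file R3, first term).  ASSEMBLY over parts 34∕35 (transports, `lap_sSm_comm_comp_pull`), 40 (`hasMaj_sK_comp`, `hasMaj_sT_pow_comp`, `hasMaj_finsum`), 41 (`hasMaj_gradStep`:
(1.111) as `η·∇∇G = O(η^α)`), 42 (`hasMaj_gDivAdj_of_ineq` at the fine member, `ineq110_114_pair`), n15-c's carrier (`unitTorusGeo`, `blkFine`, `kingPrV`,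
`blkFine_comp_kingPrV`) and lit-balaban's composition of exponential block majorants `B11SectG.hasMaj_comp_exp` (`rowSum_unitTorusGeo`, `triangle254_unitTorusGeo`).
THE ESTIMATE.  In `𝔇(G′, G) = idef P̂₂ P G′ G = −G′(Δ′_aP̂₂ − PΔ_a)G` (`T4EtaRateDefect.idef_inv`) the Laplacian part of `Δ_a = Δ − ∂Π∂* + aQ*Q` contributes
`G′(Δ′P̂₂ − P̂₂Δ)G + G′(P̂₂ − P)ΔG`; this file bounds the FIRST: `Δ′P̂₂ − P̂₂Δ = Σ_ν ρ′(sD_ν c′·k_ν)∘P∘ρ(sD_ν c)²` (`c = n = L^k = η⁻¹`, `c′ = n′ = L^m·n`),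
`sD_ν c′ = −c′(s_ν⁻¹ − 1)·s_ν` (§30), hence summand `= −[G′∘ρ′(c′(s_ν⁻¹−1))] ∘ [ρ′(s_ν)∘ρ′(k_ν)∘P∘ρ(sD_ν n)∘ρ(sD_ν n)∘G]`; the left bracket has majorant
`C₀e^{−δ₀d}` ((1.110) «G∇*J» at the fine member), the right one `e^{δ₂}·e^{(2d+3)δ₂}·(2(L^m−1)/n′)·C₂n^{1−α}·e^{−δ₂d}` (parts 41 → §29 pull → 40), and
`(2(L^m−1)/n′)·n^{1−α} ≤ 2n^{−α}`; composing (`ρ = min(δ₀/2, δ₂)`, row-sum constant `latticeConst(d+1, δ₀/2)`) and summing over `ν` gives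
★★★ **`hasMaj_lapDefect`**: `∃ δ C > 0 ∀ m_T k ≥ 1 m`, `HasMaj (ofBlocks … blkFine) (ofBlocks … blockOf_{n′}) (G′∘(Δ′∘P̂₂ − P̂₂∘Δ)∘G) (C·(L^k)^{−α}·e^{−δ tdistT})`.
CONTENTS.  §29 `hasMaj_pull_comp₂` (two bond sets); §30 `sD_eq_neg_sTinv_sub_one_mul_sT`; §31 `hasMaj_lapDefect`.
HONEST FRAMING ∕ LIMITS.  This is ONE of the four terms of the consistency operator of `Δ_a` (plan §7.2): NOT here are `G′(P̂₂ − P)ΔG` (entry «ΔGJ» + part 34's swap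
`h⁰_ν`, same mechanism, rate η), the averaging term `a·C_Q` (part 37, rate η) and the Landau term `C_V = V′P̂₂ − PV`, `V = ∂Π∂*` (plan §7.4(a): NOT in printed
currency — the located hard core); nor the output-side swap `G′(P − P̂₂)`, nor entries 1–3 of (3.42), nor the `idef` bookkeeping to `NE2ZeroOperator`.  Constants crude
and ours; Bałaban's inequalities enter only through the tree's theorem `prop12_famG_printed`; tori of record `M_μ = 2L^{m_T}`; `U ≡ 1`; count-neutral (typed 28∕28 ·
discharged 5∕28 unchanged); NOT a discharge of N15 (object-bound; NE2⁺ NOT PRINTED); one finite T⁴ at fixed ε — NOT infinite volume, NOT OS on ℝ⁴, NOT a mass gap, NOT Clay.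
-/

noncomputable section

open scoped BigOperators Matrix
open Finset

namespace Summit.QuantumFields.YangMills.BalabanUVNodes.N15.TwoGrid

open Literature.MathematicalPhysics.QuantumFieldTheory.Balaban1983to89
open Literature.MathematicalPhysics.QuantumFieldTheory.Balaban1983to89.B11SectG (BlockNorm HasMaj hasMaj_comp_exp)
open Literature.MathematicalPhysics.QuantumFieldTheory.Balaban1983to89.B11AxialTransport190 (abs_le_loc_ofBlocks loc_ofBlocks_le)
open Literature.MathematicalPhysics.QuantumFieldTheory.Balaban1983to89.T4EtaRateCoeffDefect (pull pull_apply)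
open Literature.MathematicalPhysics.QuantumFieldTheory.Balaban1983to89.B5Prop11Plancherel (Tor fine unitVec)
open Literature.MathematicalPhysics.QuantumFieldTheory.Balaban1983to89.B5SettingP12Real (latticeSettingP12R)
open Literature.MathematicalPhysics.QuantumFieldTheory.Balaban1983to89.B5SiteBridgeP12 (MP)
open Literature.MathematicalPhysics.QuantumFieldTheory.King1986.Torus (blockOf tdistT tdistT_nonneg)
open Literature.MathematicalPhysics.QuantumFieldTheory.Balaban1983to89.B6UnitTorusCarrier (unitTorusGeo unitTorusGeo_dist_nonneg triangle254_unitTorusGeo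
  rowSum_unitTorusGeo)
open Summit.QuantumFields.YangMills.BalabanUVNodes.N15.VectorPiece (blkFine blkFine_apply kingPrV kingPrV_eq blkFine_comp_kingPrV)

variable {d : ℕ}

/-! ## §29 Block-majorant transfer through a pull-back between two bond sets (King's prolongation `P = pull kingPrV`) -/

section Pull

/-- **A PULL-BACK ALONG A BLOCK-RESPECTING MAP KEEPS THE MAJORANT**: if `T` has majorant `K` into functions on `X₁` blocked by `blk₁`, then `pull s ∘ T` has any
majorant `K′ ≥ 0` with `K (blk₁ (s x)) y′ ≤ K′ (blk₂ x) y′` into functions on `X₂` blocked by `blk₂` (two-type form of n15-c's `VectorPiece.hasMaj_pull_comp`).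
[cite: King1986, p.664 (the pairing x′ ↦ x, x′ ∈ B^n(x))] -/
theorem hasMaj_pull_comp₂ {g : B6.Geometry} {X₁ X₂ : Type} [Fintype X₁] [Fintype X₂] {F₁ : Type} [AddCommGroup F₁] [Module ℝ F₁] {b₁ : BlockNorm g F₁}
    (blk₁ : X₁ → g.Site) (blk₂ : X₂ → g.Site) (s : X₂ → X₁) {T : F₁ →ₗ[ℝ] (X₁ → ℝ)} {K K' : g.Site → g.Site → ℝ}
    (hK' : ∀ y y', 0 ≤ K' y y') (hs : ∀ x y', K (blk₁ (s x)) y' ≤ K' (blk₂ x) y') (h : HasMaj b₁ (BlockNorm.ofBlocks g blk₁) T K) :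
    HasMaj b₁ (BlockNorm.ofBlocks g blk₂) (pull s ∘ₗ T) K' := by
  intro y' μ hμ y
  refine loc_ofBlocks_le blk₂ _ (mul_nonneg (hK' y y') (b₁.loc_nonneg y' μ)) fun x hx => ?_
  rw [LinearMap.comp_apply, pull_apply]
  calc |T μ (s x)| ≤ (BlockNorm.ofBlocks g blk₁).loc (blk₁ (s x)) (T μ) := abs_le_loc_ofBlocks blk₁ _ rfl
    _ ≤ K (blk₁ (s x)) y' * b₁.loc y' μ := h y' μ hμ _
    _ ≤ K' y y' * b₁.loc y' μ := by rw [← hx]; exact mul_le_mul_of_nonneg_right (hs x y') (b₁.loc_nonneg y' μ)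

end Pull

/-! ## §30 The symbol of the forward quotient through the backward one: `c(s_ν − 1) = −(c(s_ν⁻¹ − 1))·s_ν` -/

section Symbol

variable (M : Fin (d + 1) → ℕ) (n : ℕ)

/-- `c(s_ν − 1) = −(c(s_ν⁻¹ − 1))·s_ν` in the group algebra (so `∇_ν = −S_ν∇_ν^*`). [cite: Balaban1984PropagatorsI, (1.21) p.21] -/
theorem sD_eq_neg_sTinv_sub_one_mul_sT (ν : Fin (d + 1)) (c : ℝ) : sD M n ν c = -((c • (sTinv M n ν - 1)) * sT M n ν) := by
  have h := sT_mul_sTinv M n ν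
  simp only [sD, Algebra.smul_def]
  linear_combination (algebraMap ℝ (AddMonoidAlgebra ℝ (Tor (fine n M))) c) * h

end Symbol

/-! ## §31 R3, LAPLACIAN PART: the η^α block majorant of `G′∘(Δ′P̂₂ − P̂₂Δ)∘G` -/

section LapDefect

variable {L : ℕ} [NeZero L] (M : Fin (d + 1) → ℕ) [∀ μ, NeZero (M μ)] (k m : ℕ) (a : ℝ)

/-- **CORE ESTIMATE (explicit constants)** behind `hasMaj_lapDefect`: for ONE torus `M`, coarse scale `k ≥ 1`, refinement `m`, given the (1.110)–(1.114) package for the fine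
member (`HP2`) and the Hölder gain of part 41 for the coarse member (`HG`), the Laplacian part of the two-grid defect has the block majorant
`(d+1)·C₀·2C₂e^{(2d+4)δ₂}·latticeConst(d+1, δ₀/2)·(L^k)^{−α}·e^{−min(δ₀/2,δ₂)|y−y′|_T}`. [cite: Balaban1984PropagatorsI, Prop. 1.2 (1.110)–(1.111) p.35] -/
theorem hasMaj_lapDefect_core {C₀ δ₀ : ℝ} {Cα Cε : ℝ → ℝ} {Cαε : ℝ → ℝ → ℝ} (hC₀ : 0 < C₀) (hδ₀ : 0 < δ₀)
    (HP2 : B5.Ineq110_114 (latticeSettingP12R (L ^ m * L ^ k) M a (m + k)) C₀ Cα Cε Cαε δ₀) {C₂ δ₂ α : ℝ} (hC₂ : 0 < C₂) (hδ₂ : 0 < δ₂)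
    (HG : ∀ ν : Fin (d + 1), HasMaj (BlockNorm.ofBlocks (unitTorusGeo L k M) (blkFine L k M)) (BlockNorm.ofBlocks (unitTorusGeo L k M) (blkFine L k M))
      (symbOp M (L ^ k) (sD M (L ^ k) ν ((L ^ k : ℕ) : ℝ)) ∘ₗ symbOp M (L ^ k) (sD M (L ^ k) ν ((L ^ k : ℕ) : ℝ)) ∘ₗ gOp M (L ^ k) a)
      (fun y y' => C₂ * ((L ^ k : ℕ) : ℝ) ^ (1 - α) * Real.exp (-(δ₂ * tdistT M y y')))) :
    HasMaj (BlockNorm.ofBlocks (unitTorusGeo L k M) (blkFine L k M)) (BlockNorm.ofBlocks (unitTorusGeo L k M) (fun i : Tor (fine (L ^ m * L ^ k) M) × Fin (d + 1) => blockOf (L ^ m * L ^ k) M i.1))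
      (gOp M (L ^ m * L ^ k) a ∘ₗ
        ((symbOp M (L ^ m * L ^ k) (sLap M (L ^ m * L ^ k) ((L ^ m * L ^ k : ℕ) : ℝ)) ∘ₗ (symbOp M (L ^ m * L ^ k) (sSm M (L ^ m * L ^ k) (L ^ m)) ∘ₗ (pull (kingPrV L k m M))) -
            symbOp M (L ^ m * L ^ k) (sSm M (L ^ m * L ^ k) (L ^ m)) ∘ₗ ((pull (kingPrV L k m M)) ∘ₗ symbOp M (L ^ k) (sLap M (L ^ k) ((L ^ k : ℕ) : ℝ)))) ∘ₗ gOp M (L ^ k) a))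
      (fun y y' => (((d : ℝ) + 1) * (C₀ * (2 * C₂ * Real.exp δ₂ ^ (2 * d + 4)) * B4Sect5Proof.latticeConst (d + 1) (δ₀ / 2))) *
        ((L ^ k : ℕ) : ℝ) ^ (-α) * Real.exp (-(min (δ₀ / 2) δ₂ * tdistT M y y'))) := by
  have hσ0 : 0 < δ₀ / 2 := by linarith
  have hρ00 : 0 < min (δ₀ / 2) δ₂ := lt_min hσ0 hδ₂
  have hcR0 : 0 ≤ B4Sect5Proof.latticeConst (d + 1) (δ₀ / 2) := B4Sect5Proof.latticeConst_nonneg (d + 1) hσ0.le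
  have hL0 : 0 < L := Nat.pos_of_ne_zero (NeZero.ne L)
  have hn1 : 1 ≤ L ^ k := Nat.one_le_pow _ _ hL0
  have hR1 : 1 ≤ L ^ m := Nat.one_le_pow _ _ hL0
  have hn'1 : 1 ≤ L ^ m * L ^ k := Nat.one_le_iff_ne_zero.mpr (Nat.mul_ne_zero (by positivity) (by positivity))
  have hn0 : (0 : ℝ) < ((L ^ k : ℕ) : ℝ) := by exact_mod_cast hn1
  have hn'0 : (0 : ℝ) < ((L ^ m * L ^ k : ℕ) : ℝ) := by exact_mod_cast hn'1
  have hRn' : L ^ m ≤ L ^ m * L ^ k := Nat.le_mul_of_pos_right _ hn1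
  have hR1r : (1 : ℝ) ≤ ((L ^ m : ℕ) : ℝ) := by exact_mod_cast hR1
  -- (1) the commutator identity of part 35 at `c = n`, `c′ = n·L^m = n′`
  have hc' : ((L ^ k : ℕ) : ℝ) * (L : ℝ) ^ m = ((L ^ m * L ^ k : ℕ) : ℝ) := by push_cast; ring
  have hcomm := lap_sSm_comm_comp_pull M L k m (c := ((L ^ k : ℕ) : ℝ)) hn0.ne'
  rw [hc'] at hcomm
  -- (2) the right factor of each summand: `S_ν ∘ ρ′(k_ν) ∘ P ∘ ρ(sD_ν n) ∘ ρ(sD_ν n) ∘ G`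
  have hT : ∀ ν : Fin (d + 1), HasMaj (BlockNorm.ofBlocks (unitTorusGeo L k M) (blkFine L k M)) (BlockNorm.ofBlocks (unitTorusGeo L k M) (fun i : Tor (fine (L ^ m * L ^ k) M) × Fin (d + 1) => blockOf (L ^ m * L ^ k) M i.1))
      (symbOp M (L ^ m * L ^ k) (sT M (L ^ m * L ^ k) ν) ∘ₗ (symbOp M (L ^ m * L ^ k) (sK M (L ^ m * L ^ k) ν (L ^ m) ((L ^ m * L ^ k : ℕ) : ℝ)) ∘ₗ
        ((pull (kingPrV L k m M)) ∘ₗ (symbOp M (L ^ k) (sD M (L ^ k) ν ((L ^ k : ℕ) : ℝ)) ∘ₗ symbOp M (L ^ k) (sD M (L ^ k) ν ((L ^ k : ℕ) : ℝ)) ∘ₗ gOp M (L ^ k) a))))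
      (fun y y' => 2 * (((L ^ m : ℕ) : ℝ) - 1) / ((L ^ m * L ^ k : ℕ) : ℝ) * (C₂ * ((L ^ k : ℕ) : ℝ) ^ (1 - α)) * Real.exp δ₂ ^ (2 * d + 3) * Real.exp δ₂ *
        Real.exp (-(δ₂ * tdistT M y y'))) := by
    intro ν
    have hKnn : ∀ y y' : Tor M, 0 ≤ C₂ * ((L ^ k : ℕ) : ℝ) ^ (1 - α) * Real.exp (-(δ₂ * tdistT M y y')) := fun y y' =>
      mul_nonneg (mul_nonneg hC₂.le (Real.rpow_nonneg hn0.le _)) (Real.exp_nonneg _)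
    have hPY := hasMaj_pull_comp₂ (g := unitTorusGeo L k M) (b₁ := (BlockNorm.ofBlocks (unitTorusGeo L k M) (blkFine L k M))) (blkFine L k M)
      (fun i : Tor (fine (L ^ m * L ^ k) M) × Fin (d + 1) => blockOf (L ^ m * L ^ k) M i.1) (kingPrV L k m M) hKnn
      (fun x y' => le_of_eq (by
        have hx : blkFine L k M (kingPrV L k m M x) = blockOf (L ^ m * L ^ k) M x.1 := congrFun (blkFine_comp_kingPrV M L k m) x
        rw [hx])) (HG ν)
    have hB1 : 0 ≤ C₂ * ((L ^ k : ℕ) : ℝ) ^ (1 - α) := mul_nonneg hC₂.le (Real.rpow_nonneg hn0.le _)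
    have hKk := hasMaj_sK_comp M k (L ^ m * L ^ k) (b₁ := (BlockNorm.ofBlocks (unitTorusGeo L k M) (blkFine L k M))) hB1 hδ₂.le (R := L ^ m) (by positivity) hRn' hn'0 ν hPY
    have hB2 : 0 ≤ 2 * (((L ^ m : ℕ) : ℝ) - 1) / ((L ^ m * L ^ k : ℕ) : ℝ) * (C₂ * ((L ^ k : ℕ) : ℝ) ^ (1 - α)) * Real.exp δ₂ ^ (2 * d + 3) :=
      mul_nonneg (mul_nonneg (div_nonneg (mul_nonneg zero_le_two (by linarith)) hn'0.le) hB1) (pow_nonneg (Real.exp_nonneg _) _)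
    have hKk' := hKk.mono (K' := fun y y' => 2 * (((L ^ m : ℕ) : ℝ) - 1) / ((L ^ m * L ^ k : ℕ) : ℝ) * (C₂ * ((L ^ k : ℕ) : ℝ) ^ (1 - α)) * Real.exp δ₂ ^ (2 * d + 3) *
      Real.exp (-(δ₂ * tdistT M y y'))) fun y y' => le_of_eq (by ring)
    have hS := hasMaj_sT_pow_comp M k (L ^ m * L ^ k) hB2 hδ₂.le ν (j := 1) hn'1 hKk'
    rw [pow_one] at hS
    exact hS
  -- (3) the left factor: (1.110) «G∇*J» for the fine member
  have hX : ∀ ν : Fin (d + 1), HasMaj (BlockNorm.ofBlocks (unitTorusGeo L k M) (fun i : Tor (fine (L ^ m * L ^ k) M) × Fin (d + 1) => blockOf (L ^ m * L ^ k) M i.1)) (BlockNorm.ofBlocks (unitTorusGeo L k M) (fun i : Tor (fine (L ^ m * L ^ k) M) × Fin (d + 1) => blockOf (L ^ m * L ^ k) M i.1)) (gOp M (L ^ m * L ^ k) a ∘ₗ symbOp M (L ^ m * L ^ k) (((L ^ m * L ^ k : ℕ) : ℝ) • (sTinv M (L ^ m * L ^ k) ν - 1)))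
      (fun y y' => C₀ * Real.exp (-(δ₀ * tdistT M y y'))) :=
    fun ν => hasMaj_gDivAdj_of_ineq M k (L ^ m * L ^ k) a hn'1 HP2 hC₀.le ν
  -- (4) composition on the unit torus
  have hcomp : ∀ ν : Fin (d + 1), HasMaj (BlockNorm.ofBlocks (unitTorusGeo L k M) (blkFine L k M)) (BlockNorm.ofBlocks (unitTorusGeo L k M) (fun i : Tor (fine (L ^ m * L ^ k) M) × Fin (d + 1) => blockOf (L ^ m * L ^ k) M i.1))
      ((gOp M (L ^ m * L ^ k) a ∘ₗ symbOp M (L ^ m * L ^ k) (((L ^ m * L ^ k : ℕ) : ℝ) • (sTinv M (L ^ m * L ^ k) ν - 1))) ∘ₗ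
        (symbOp M (L ^ m * L ^ k) (sT M (L ^ m * L ^ k) ν) ∘ₗ (symbOp M (L ^ m * L ^ k) (sK M (L ^ m * L ^ k) ν (L ^ m) ((L ^ m * L ^ k : ℕ) : ℝ)) ∘ₗ
          ((pull (kingPrV L k m M)) ∘ₗ (symbOp M (L ^ k) (sD M (L ^ k) ν ((L ^ k : ℕ) : ℝ)) ∘ₗ symbOp M (L ^ k) (sD M (L ^ k) ν ((L ^ k : ℕ) : ℝ)) ∘ₗ gOp M (L ^ k) a)))))
      (fun y y' => (BlockNorm.ofBlocks (unitTorusGeo L k M) (fun i : Tor (fine (L ^ m * L ^ k) M) × Fin (d + 1) => blockOf (L ^ m * L ^ k) M i.1)).κ * C₀ * (2 * (((L ^ m : ℕ) : ℝ) - 1) / ((L ^ m * L ^ k : ℕ) : ℝ) * (C₂ * ((L ^ k : ℕ) : ℝ) ^ (1 - α)) * Real.exp δ₂ ^ (2 * d + 3) * Real.exp δ₂) *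
        B4Sect5Proof.latticeConst (d + 1) (δ₀ / 2) * Real.exp (-(min (δ₀ / 2) δ₂ * tdistT M y y'))) := by
    intro ν
    exact hasMaj_comp_exp (b₁ := (BlockNorm.ofBlocks (unitTorusGeo L k M) (blkFine L k M))) (b₂ := (BlockNorm.ofBlocks (unitTorusGeo L k M) (fun i : Tor (fine (L ^ m * L ^ k) M) × Fin (d + 1) => blockOf (L ^ m * L ^ k) M i.1))) (b₃ := (BlockNorm.ofBlocks (unitTorusGeo L k M) (fun i : Tor (fine (L ^ m * L ^ k) M) × Fin (d + 1) => blockOf (L ^ m * L ^ k) M i.1))) (triangle254_unitTorusGeo L k M) (unitTorusGeo_dist_nonneg L k M)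
      (rowSum_unitTorusGeo L k M hσ0) hC₀.le
      (mul_nonneg (mul_nonneg (mul_nonneg (div_nonneg (mul_nonneg zero_le_two (by linarith)) hn'0.le)
        (mul_nonneg hC₂.le (Real.rpow_nonneg hn0.le _))) (pow_nonneg (Real.exp_nonneg _) _)) (Real.exp_nonneg _))
      hρ00.le (min_le_right _ _) (by linarith [min_le_left (δ₀ / 2) δ₂]) (hX ν) (hT ν)
  -- (5) each summand of `G′(Δ′P̂₂ − P̂₂Δ)G` is minus such a composition
  have hpiece : ∀ ν : Fin (d + 1),
      gOp M (L ^ m * L ^ k) a ∘ₗ ((symbOp M (L ^ m * L ^ k) (sD M (L ^ m * L ^ k) ν ((L ^ m * L ^ k : ℕ) : ℝ) * sK M (L ^ m * L ^ k) ν (L ^ m) ((L ^ m * L ^ k : ℕ) : ℝ)) ∘ₗ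
          ((pull (kingPrV L k m M)) ∘ₗ symbOp M (L ^ k) (sD M (L ^ k) ν ((L ^ k : ℕ) : ℝ) ^ 2))) ∘ₗ gOp M (L ^ k) a)
        = -((gOp M (L ^ m * L ^ k) a ∘ₗ symbOp M (L ^ m * L ^ k) (((L ^ m * L ^ k : ℕ) : ℝ) • (sTinv M (L ^ m * L ^ k) ν - 1))) ∘ₗ
            (symbOp M (L ^ m * L ^ k) (sT M (L ^ m * L ^ k) ν) ∘ₗ (symbOp M (L ^ m * L ^ k) (sK M (L ^ m * L ^ k) ν (L ^ m) ((L ^ m * L ^ k : ℕ) : ℝ)) ∘ₗ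
              ((pull (kingPrV L k m M)) ∘ₗ (symbOp M (L ^ k) (sD M (L ^ k) ν ((L ^ k : ℕ) : ℝ)) ∘ₗ symbOp M (L ^ k) (sD M (L ^ k) ν ((L ^ k : ℕ) : ℝ)) ∘ₗ gOp M (L ^ k) a))))) := by
    intro ν
    rw [sD_eq_neg_sTinv_sub_one_mul_sT M (L ^ m * L ^ k) ν ((L ^ m * L ^ k : ℕ) : ℝ), neg_mul, map_neg, mul_assoc, map_mul, map_mul, map_pow, pow_two]
    simp only [Module.End.mul_eq_comp, LinearMap.neg_comp, LinearMap.comp_neg, LinearMap.comp_assoc]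
  have hsummand : ∀ ν : Fin (d + 1), HasMaj (BlockNorm.ofBlocks (unitTorusGeo L k M) (blkFine L k M)) (BlockNorm.ofBlocks (unitTorusGeo L k M) (fun i : Tor (fine (L ^ m * L ^ k) M) × Fin (d + 1) => blockOf (L ^ m * L ^ k) M i.1))
      (gOp M (L ^ m * L ^ k) a ∘ₗ ((symbOp M (L ^ m * L ^ k) (sD M (L ^ m * L ^ k) ν ((L ^ m * L ^ k : ℕ) : ℝ) * sK M (L ^ m * L ^ k) ν (L ^ m) ((L ^ m * L ^ k : ℕ) : ℝ)) ∘ₗ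
          ((pull (kingPrV L k m M)) ∘ₗ symbOp M (L ^ k) (sD M (L ^ k) ν ((L ^ k : ℕ) : ℝ) ^ 2))) ∘ₗ gOp M (L ^ k) a))
      (fun y y' => (BlockNorm.ofBlocks (unitTorusGeo L k M) (fun i : Tor (fine (L ^ m * L ^ k) M) × Fin (d + 1) => blockOf (L ^ m * L ^ k) M i.1)).κ * C₀ * (2 * (((L ^ m : ℕ) : ℝ) - 1) / ((L ^ m * L ^ k : ℕ) : ℝ) * (C₂ * ((L ^ k : ℕ) : ℝ) ^ (1 - α)) * Real.exp δ₂ ^ (2 * d + 3) * Real.exp δ₂) *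
        B4Sect5Proof.latticeConst (d + 1) (δ₀ / 2) * Real.exp (-(min (δ₀ / 2) δ₂ * tdistT M y y'))) := fun ν => by
    rw [hpiece ν]
    exact (hcomp ν).neg
  -- (6) sum over the directions, and the target operator
  have hsum := hasMaj_finsum (g := unitTorusGeo L k M) (b₁ := (BlockNorm.ofBlocks (unitTorusGeo L k M) (blkFine L k M))) (b₂ := (BlockNorm.ofBlocks (unitTorusGeo L k M) (fun i : Tor (fine (L ^ m * L ^ k) M) × Fin (d + 1) => blockOf (L ^ m * L ^ k) M i.1))) Finset.univ
    (fun ν => gOp M (L ^ m * L ^ k) a ∘ₗ ((symbOp M (L ^ m * L ^ k) (sD M (L ^ m * L ^ k) ν ((L ^ m * L ^ k : ℕ) : ℝ) * sK M (L ^ m * L ^ k) ν (L ^ m) ((L ^ m * L ^ k : ℕ) : ℝ)) ∘ₗ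
      ((pull (kingPrV L k m M)) ∘ₗ symbOp M (L ^ k) (sD M (L ^ k) ν ((L ^ k : ℕ) : ℝ) ^ 2))) ∘ₗ gOp M (L ^ k) a))
    (fun _ y y' => (BlockNorm.ofBlocks (unitTorusGeo L k M) (fun i : Tor (fine (L ^ m * L ^ k) M) × Fin (d + 1) => blockOf (L ^ m * L ^ k) M i.1)).κ * C₀ * (2 * (((L ^ m : ℕ) : ℝ) - 1) / ((L ^ m * L ^ k : ℕ) : ℝ) * (C₂ * ((L ^ k : ℕ) : ℝ) ^ (1 - α)) * Real.exp δ₂ ^ (2 * d + 3) * Real.exp δ₂) *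
        B4Sect5Proof.latticeConst (d + 1) (δ₀ / 2) * Real.exp (-(min (δ₀ / 2) δ₂ * tdistT M y y'))) fun ν _ => hsummand ν
  have hcommw := fun w => LinearMap.congr_fun hcomm w
  refine (hsum.congr fun μ => ?_).mono fun y y' => ?_
  · -- the operator: `Σ_ν G′∘S_ν∘G = G′∘(Δ′P̂₂ − P̂₂Δ)∘G`
    simp only [LinearMap.sum_apply, LinearMap.comp_apply]
    rw [hcommw, LinearMap.sum_apply, map_sum]
    simp only [LinearMap.comp_apply]
  · -- the constant
    have hκ : (BlockNorm.ofBlocks (unitTorusGeo L k M) (fun i : Tor (fine (L ^ m * L ^ k) M) × Fin (d + 1) => blockOf (L ^ m * L ^ k) M i.1)).κ = 1 := rfl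
    have hE := Real.exp_nonneg (-(min (δ₀ / 2) δ₂ * tdistT M y y'))
    have hrate : 2 * (((L ^ m : ℕ) : ℝ) - 1) / ((L ^ m * L ^ k : ℕ) : ℝ) * (C₂ * ((L ^ k : ℕ) : ℝ) ^ (1 - α)) ≤ 2 * C₂ * ((L ^ k : ℕ) : ℝ) ^ (-α) := by
      have hR0 : (0 : ℝ) < ((L ^ m : ℕ) : ℝ) := by linarith
      have hn'c : ((L ^ m * L ^ k : ℕ) : ℝ) = ((L ^ m : ℕ) : ℝ) * ((L ^ k : ℕ) : ℝ) := by push_cast; ring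
      have hpow : ((L ^ k : ℕ) : ℝ) ^ (1 - α) = ((L ^ k : ℕ) : ℝ) * ((L ^ k : ℕ) : ℝ) ^ (-α) := by
        rw [show (1 - α) = 1 + -α by ring, Real.rpow_add hn0, Real.rpow_one]
      rw [hn'c, hpow]
      have hq : (((L ^ m : ℕ) : ℝ) - 1) / ((L ^ m : ℕ) : ℝ) ≤ 1 := by rw [div_le_one hR0]; linarith
      have hnα : 0 ≤ ((L ^ k : ℕ) : ℝ) ^ (-α) := Real.rpow_nonneg hn0.le _
      calc 2 * (((L ^ m : ℕ) : ℝ) - 1) / (((L ^ m : ℕ) : ℝ) * ((L ^ k : ℕ) : ℝ)) * (C₂ * (((L ^ k : ℕ) : ℝ) * ((L ^ k : ℕ) : ℝ) ^ (-α)))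
          = 2 * C₂ * ((L ^ k : ℕ) : ℝ) ^ (-α) * ((((L ^ m : ℕ) : ℝ) - 1) / ((L ^ m : ℕ) : ℝ)) := by field_simp
        _ ≤ 2 * C₂ * ((L ^ k : ℕ) : ℝ) ^ (-α) * 1 := mul_le_mul_of_nonneg_left hq (mul_nonneg (mul_nonneg zero_le_two hC₂.le) hnα)
        _ = 2 * C₂ * ((L ^ k : ℕ) : ℝ) ^ (-α) := mul_one _
    rw [Finset.sum_const, Finset.card_univ, Fintype.card_fin, nsmul_eq_mul, hκ, Nat.cast_succ]
    have hexp4 : Real.exp δ₂ ^ (2 * d + 3) * Real.exp δ₂ = Real.exp δ₂ ^ (2 * d + 4) := by rw [← pow_succ]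
    have hmid : C₀ * (2 * (((L ^ m : ℕ) : ℝ) - 1) / ((L ^ m * L ^ k : ℕ) : ℝ) * (C₂ * ((L ^ k : ℕ) : ℝ) ^ (1 - α)) * Real.exp δ₂ ^ (2 * d + 4)) * B4Sect5Proof.latticeConst (d + 1) (δ₀ / 2)
        ≤ C₀ * (2 * C₂ * ((L ^ k : ℕ) : ℝ) ^ (-α) * Real.exp δ₂ ^ (2 * d + 4)) * B4Sect5Proof.latticeConst (d + 1) (δ₀ / 2) :=
      mul_le_mul_of_nonneg_right (mul_le_mul_of_nonneg_left (mul_le_mul_of_nonneg_right hrate (pow_nonneg (Real.exp_nonneg _) _)) hC₀.le) hcR0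
    have hd1 : (0 : ℝ) ≤ (d : ℝ) + 1 := by positivity
    calc ((d : ℝ) + 1) * (1 * C₀ * (2 * (((L ^ m : ℕ) : ℝ) - 1) / ((L ^ m * L ^ k : ℕ) : ℝ) * (C₂ * ((L ^ k : ℕ) : ℝ) ^ (1 - α)) * Real.exp δ₂ ^ (2 * d + 3) * Real.exp δ₂) *
          B4Sect5Proof.latticeConst (d + 1) (δ₀ / 2) * Real.exp (-(min (δ₀ / 2) δ₂ * tdistT M y y')))
        = ((d : ℝ) + 1) * (C₀ * (2 * (((L ^ m : ℕ) : ℝ) - 1) / ((L ^ m * L ^ k : ℕ) : ℝ) * (C₂ * ((L ^ k : ℕ) : ℝ) ^ (1 - α)) * Real.exp δ₂ ^ (2 * d + 4)) *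
            B4Sect5Proof.latticeConst (d + 1) (δ₀ / 2)) * Real.exp (-(min (δ₀ / 2) δ₂ * tdistT M y y')) := by rw [← hexp4]; ring
      _ ≤ ((d : ℝ) + 1) * (C₀ * (2 * C₂ * ((L ^ k : ℕ) : ℝ) ^ (-α) * Real.exp δ₂ ^ (2 * d + 4)) * B4Sect5Proof.latticeConst (d + 1) (δ₀ / 2)) *
            Real.exp (-(min (δ₀ / 2) δ₂ * tdistT M y y')) :=
          mul_le_mul_of_nonneg_right (mul_le_mul_of_nonneg_left hmid hd1) hE
      _ = (((d : ℝ) + 1) * (C₀ * (2 * C₂ * Real.exp δ₂ ^ (2 * d + 4)) * B4Sect5Proof.latticeConst (d + 1) (δ₀ / 2))) * ((L ^ k : ℕ) : ℝ) ^ (-α) *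
            Real.exp (-(min (δ₀ / 2) δ₂ * tdistT M y y')) := by ring

/-- ★★★ **THE LAPLACIAN PART OF THE TWO-GRID DEFECT OF BAŁABAN's PROPAGATORS IS `O(η^α)` IN BLOCK-MAJORANT CURRENCY, HYPOTHESIS-FREE.**  For odd `L > 1`, `a > 0`,
`0 ≤ α < 1` there are `δ, C > 0` such that for every torus exponent `m_T`, every coarse scale `k ≥ 1` (`η = L^{−k}`, `n = L^k`) and every refinement `m`
(`n′ = L^m·L^k`), with `G = Δ_a⁻¹` on `T_η` (`gOp M (L^k) a`), `G′` the same on `T_{η′}` (`gOp M (L^m·L^k) a`), King's prolongation `P = pull kingPrV`, the smoothed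
prolongation `P̂₂ = ρ′(Π_νa_ν(L^m)²)∘P` and the Laplacians `Δ = ρ(sLap n)`, `Δ′ = ρ′(sLap n′)`:
`G′∘(Δ′P̂₂ − P̂₂Δ)∘G` has the block majorant `C·(L^k)^{−α}·e^{−δ|y−y′|_T}` from coarse 1-forms blocked by King's unit blocks to fine 1-forms blocked likewise.
MECHANISM (plan §7.1(ii)∕§7.2): `Δ′P̂₂ − P̂₂Δ = Σ_ν ρ′(sD_ν c′·k_ν)∘P∘ρ(sD_ν c)²` (part 35) and `sD_ν c′ = −c′(s_ν⁻¹−1)·s_ν`, so each summand of `G′(…)G` is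
`−[G′∇′_ν^*]∘[S_ν∘ρ′(k_ν)∘P∘(η∇_ν∇_νG)·η⁻¹]`: the left factor is (1.110) entry «G∇*J» for `G′` (part 42 at the fine member), the right one is
`e^{δ}·(2(L^m−1)/n′)·(C₂ n^{1−α})` by parts 40∕41 — net `(L^k)^{−α} = η^α` — and the two exponential majorants compose by `B11SectG.hasMaj_comp_exp` on the unit torus
(`rowSum_unitTorusGeo`, `triangle254_unitTorusGeo`). [cite: Balaban1984PropagatorsI, Prop. 1.2 (1.110)–(1.111) p.35; King1986, Prop. 3.9 p.664 (η-rate shape)] -/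
theorem hasMaj_lapDefect (hL : Odd L ∧ 1 < L) {a : ℝ} (ha : 0 < a) {α : ℝ} (hα0 : 0 ≤ α) (hα1 : α < 1) :
    ∃ δ C : ℝ, 0 < δ ∧ 0 < C ∧ ∀ (mT k m : ℕ) (hk : 1 ≤ k),
      HasMaj (BlockNorm.ofBlocks (unitTorusGeo L k (MP (paramsOf d L mT k hL))) (blkFine L k (MP (paramsOf d L mT k hL))))
        (BlockNorm.ofBlocks (unitTorusGeo L k (MP (paramsOf d L mT k hL)))
          (fun i : Tor (fine (L ^ m * L ^ k) (MP (paramsOf d L mT k hL))) × Fin (d + 1) => blockOf (L ^ m * L ^ k) (MP (paramsOf d L mT k hL)) i.1))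
        (gOp (MP (paramsOf d L mT k hL)) (L ^ m * L ^ k) a ∘ₗ
          ((symbOp (MP (paramsOf d L mT k hL)) (L ^ m * L ^ k) (sLap (MP (paramsOf d L mT k hL)) (L ^ m * L ^ k) ((L ^ m * L ^ k : ℕ) : ℝ)) ∘ₗ
              (symbOp (MP (paramsOf d L mT k hL)) (L ^ m * L ^ k) (sSm (MP (paramsOf d L mT k hL)) (L ^ m * L ^ k) (L ^ m)) ∘ₗ
                pull (kingPrV L k m (MP (paramsOf d L mT k hL)))) -
            symbOp (MP (paramsOf d L mT k hL)) (L ^ m * L ^ k) (sSm (MP (paramsOf d L mT k hL)) (L ^ m * L ^ k) (L ^ m)) ∘ₗ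
              (pull (kingPrV L k m (MP (paramsOf d L mT k hL))) ∘ₗ
                symbOp (MP (paramsOf d L mT k hL)) (L ^ k) (sLap (MP (paramsOf d L mT k hL)) (L ^ k) ((L ^ k : ℕ) : ℝ)))) ∘ₗ
            gOp (MP (paramsOf d L mT k hL)) (L ^ k) a))
        (fun y y' => C * ((L ^ k : ℕ) : ℝ) ^ (-α) * Real.exp (-(δ * tdistT (MP (paramsOf d L mT k hL)) y y'))) := by
  obtain ⟨δ₀, C₀, Cα, Cε, Cαε, hδ₀, hC₀, HP⟩ := ineq110_114_pair (d := d) hL ha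
  obtain ⟨δ₂, C₂, hδ₂, hC₂, HG⟩ := hasMaj_gradStep (d := d) hL ha hα0 hα1
  have hcR0 : 0 ≤ B4Sect5Proof.latticeConst (d + 1) (δ₀ / 2) := B4Sect5Proof.latticeConst_nonneg (d + 1) (by linarith)
  refine ⟨min (δ₀ / 2) δ₂, ((d : ℝ) + 1) * (C₀ * (2 * C₂ * Real.exp δ₂ ^ (2 * d + 4)) * B4Sect5Proof.latticeConst (d + 1) (δ₀ / 2)) + 1,
    lt_min (by linarith) hδ₂, by positivity, fun mT k m hk => ?_⟩
  refine (hasMaj_lapDefect_core (MP (paramsOf d L mT k hL)) k m a hC₀ hδ₀ (HP mT k m hk).2 hC₂ hδ₂ fun ν => HG mT k hk ν ν).mono fun y y' => ?_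
  have hn0 : (0 : ℝ) < ((L ^ k : ℕ) : ℝ) := by exact_mod_cast Nat.one_le_pow _ _ (Nat.pos_of_ne_zero (NeZero.ne L))
  exact mul_le_mul_of_nonneg_right (mul_le_mul_of_nonneg_right (by linarith) (Real.rpow_nonneg hn0.le _)) (Real.exp_nonneg _)

/-- **CORE ESTIMATE (explicit constants)** behind `hasMaj_swapLapDefect`. [cite: Balaban1984PropagatorsI, Prop. 1.2 (1.110) p.35] -/
theorem hasMaj_swapLapDefect_core {C₀ δ₀ : ℝ} {Cα Cε : ℝ → ℝ} {Cαε : ℝ → ℝ → ℝ} (hC₀ : 0 < C₀) (hδ₀ : 0 < δ₀)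
    (HP1 : B5.Ineq110_114 (latticeSettingP12R (L ^ k) M a k) C₀ Cα Cε Cαε δ₀)
    (HP2 : B5.Ineq110_114 (latticeSettingP12R (L ^ m * L ^ k) M a (m + k)) C₀ Cα Cε Cαε δ₀) :
    HasMaj (BlockNorm.ofBlocks (unitTorusGeo L k M) (blkFine L k M)) (BlockNorm.ofBlocks (unitTorusGeo L k M) (fun i : Tor (fine (L ^ m * L ^ k) M) × Fin (d + 1) => blockOf (L ^ m * L ^ k) M i.1))
      (gOp M (L ^ m * L ^ k) a ∘ₗ ((symbOp M (L ^ m * L ^ k) (sSm M (L ^ m * L ^ k) (L ^ m)) ∘ₗ (pull (kingPrV L k m M)) - (pull (kingPrV L k m M))) ∘ₗ (symbOp M (L ^ k) (sLap M (L ^ k) ((L ^ k : ℕ) : ℝ)) ∘ₗ gOp M (L ^ k) a)))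
      (fun y y' => (((d : ℝ) + 1) * (C₀ * (C₀ * Real.exp δ₀ ^ (2 * d + 5)) * B4Sect5Proof.latticeConst (d + 1) (δ₀ / 2))) * ((L ^ k : ℕ) : ℝ)⁻¹ *
        Real.exp (-(δ₀ / 2 * tdistT M y y'))) := by
  have hσ0 : 0 < δ₀ / 2 := by linarith
  have hcR0 : 0 ≤ B4Sect5Proof.latticeConst (d + 1) (δ₀ / 2) := B4Sect5Proof.latticeConst_nonneg (d + 1) hσ0.le
  have hL0 : 0 < L := Nat.pos_of_ne_zero (NeZero.ne L)
  have hn1 : 1 ≤ L ^ k := Nat.one_le_pow _ _ hL0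
  have hR1 : 1 ≤ L ^ m := Nat.one_le_pow _ _ hL0
  have hn'1 : 1 ≤ L ^ m * L ^ k := Nat.one_le_iff_ne_zero.mpr (Nat.mul_ne_zero (by positivity) (by positivity))
  have hn0 : (0 : ℝ) < ((L ^ k : ℕ) : ℝ) := by exact_mod_cast hn1
  have hn'0 : (0 : ℝ) < ((L ^ m * L ^ k : ℕ) : ℝ) := by exact_mod_cast hn'1
  have hRn' : L ^ m ≤ L ^ m * L ^ k := Nat.le_mul_of_pos_right _ hn1
  have hR1r : (1 : ℝ) ≤ ((L ^ m : ℕ) : ℝ) := by exact_mod_cast hR1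
  -- (1) part 34's swap identity at `c′ = n′`
  have hswap : symbOp M (L ^ m * L ^ k) (sSm M (L ^ m * L ^ k) (L ^ m)) ∘ₗ (pull (kingPrV L k m M)) - (pull (kingPrV L k m M))
      = -((∑ ν : Fin (d + 1), symbOp M (L ^ m * L ^ k) (sD M (L ^ m * L ^ k) ν ((L ^ m * L ^ k : ℕ) : ℝ)) * symbOp M (L ^ m * L ^ k) (sH M (L ^ m * L ^ k) (L ^ m) ((L ^ m * L ^ k : ℕ) : ℝ) ν)) ∘ₗ (pull (kingPrV L k m M))) := by
    rw [← neg_sub, pull_sub_sSm_comp_pull M L k m (c := ((L ^ m * L ^ k : ℕ) : ℝ)) hn'0.ne']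
  -- (2) the right factor `ρ′(s_ν)∘ρ′(h⁰_ν)∘P∘Δ∘G`
  have hT : ∀ ν : Fin (d + 1), HasMaj (BlockNorm.ofBlocks (unitTorusGeo L k M) (fun i : Tor (fine (L ^ k) M) × Fin (d + 1) => blockOf (L ^ k) M i.1)) (BlockNorm.ofBlocks (unitTorusGeo L k M) (fun i : Tor (fine (L ^ m * L ^ k) M) × Fin (d + 1) => blockOf (L ^ m * L ^ k) M i.1))
      (symbOp M (L ^ m * L ^ k) (sT M (L ^ m * L ^ k) ν) ∘ₗ (symbOp M (L ^ m * L ^ k) (sH M (L ^ m * L ^ k) (L ^ m) ((L ^ m * L ^ k : ℕ) : ℝ) ν) ∘ₗ ((pull (kingPrV L k m M)) ∘ₗ (symbOp M (L ^ k) (sLap M (L ^ k) ((L ^ k : ℕ) : ℝ)) ∘ₗ gOp M (L ^ k) a))))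
      (fun y y' => (((L ^ m : ℕ) : ℝ) - 1) / ((L ^ m * L ^ k : ℕ) : ℝ) * C₀ * Real.exp δ₀ ^ (2 * d + 4) * Real.exp δ₀ * Real.exp (-(δ₀ * tdistT M y y'))) := by
    intro ν
    have h3 := hasMaj_lap_of_ineq (L := L) M k (L ^ k) a hn1 HP1 hC₀.le
    have hKnn : ∀ y y' : Tor M, 0 ≤ C₀ * Real.exp (-(δ₀ * tdistT M y y')) := fun y y' => mul_nonneg hC₀.le (Real.exp_nonneg _)
    have hP3 := hasMaj_pull_comp₂ (g := (unitTorusGeo L k M)) (fun i : Tor (fine (L ^ k) M) × Fin (d + 1) => blockOf (L ^ k) M i.1)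
      (fun i : Tor (fine (L ^ m * L ^ k) M) × Fin (d + 1) => blockOf (L ^ m * L ^ k) M i.1) (kingPrV L k m M) hKnn
      (fun x y' => le_of_eq (by
        have hx : blockOf (L ^ k) M (kingPrV L k m M x).1 = blockOf (L ^ m * L ^ k) M x.1 := congrFun (blkFine_comp_kingPrV M L k m) x
        rw [hx])) h3
    have hH := hasMaj_sH_comp M k (L ^ m * L ^ k) hC₀.le hδ₀.le (R := L ^ m) (by positivity) hRn' (c := ((L ^ m * L ^ k : ℕ) : ℝ)) hn'0 ν hP3
    have hB2 : 0 ≤ (((L ^ m : ℕ) : ℝ) - 1) / ((L ^ m * L ^ k : ℕ) : ℝ) * C₀ * Real.exp δ₀ ^ (2 * d + 4) :=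
      mul_nonneg (mul_nonneg (div_nonneg (by linarith) hn'0.le) hC₀.le) (pow_nonneg (Real.exp_nonneg _) _)
    have hH' := hH.mono (K' := fun y y' => (((L ^ m : ℕ) : ℝ) - 1) / ((L ^ m * L ^ k : ℕ) : ℝ) * C₀ * Real.exp δ₀ ^ (2 * d + 4) * Real.exp (-(δ₀ * tdistT M y y')))
      fun y y' => le_of_eq (by ring)
    have hS := hasMaj_sT_pow_comp M k (L ^ m * L ^ k) hB2 hδ₀.le ν (j := 1) hn'1 hH'
    rw [pow_one] at hS
    exact hS
  -- (3) the left factor and the composition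
  have hX : ∀ ν : Fin (d + 1), HasMaj (BlockNorm.ofBlocks (unitTorusGeo L k M) (fun i : Tor (fine (L ^ m * L ^ k) M) × Fin (d + 1) => blockOf (L ^ m * L ^ k) M i.1)) (BlockNorm.ofBlocks (unitTorusGeo L k M) (fun i : Tor (fine (L ^ m * L ^ k) M) × Fin (d + 1) => blockOf (L ^ m * L ^ k) M i.1)) (gOp M (L ^ m * L ^ k) a ∘ₗ symbOp M (L ^ m * L ^ k) (((L ^ m * L ^ k : ℕ) : ℝ) • (sTinv M (L ^ m * L ^ k) ν - 1)))
      (fun y y' => C₀ * Real.exp (-(δ₀ * tdistT M y y'))) :=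
    fun ν => hasMaj_gDivAdj_of_ineq M k (L ^ m * L ^ k) a hn'1 HP2 hC₀.le ν
  have hcomp : ∀ ν : Fin (d + 1), HasMaj (BlockNorm.ofBlocks (unitTorusGeo L k M) (fun i : Tor (fine (L ^ k) M) × Fin (d + 1) => blockOf (L ^ k) M i.1)) (BlockNorm.ofBlocks (unitTorusGeo L k M) (fun i : Tor (fine (L ^ m * L ^ k) M) × Fin (d + 1) => blockOf (L ^ m * L ^ k) M i.1))
      ((gOp M (L ^ m * L ^ k) a ∘ₗ symbOp M (L ^ m * L ^ k) (((L ^ m * L ^ k : ℕ) : ℝ) • (sTinv M (L ^ m * L ^ k) ν - 1))) ∘ₗ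
        (symbOp M (L ^ m * L ^ k) (sT M (L ^ m * L ^ k) ν) ∘ₗ (symbOp M (L ^ m * L ^ k) (sH M (L ^ m * L ^ k) (L ^ m) ((L ^ m * L ^ k : ℕ) : ℝ) ν) ∘ₗ ((pull (kingPrV L k m M)) ∘ₗ (symbOp M (L ^ k) (sLap M (L ^ k) ((L ^ k : ℕ) : ℝ)) ∘ₗ gOp M (L ^ k) a)))))
      (fun y y' => (BlockNorm.ofBlocks (unitTorusGeo L k M) (fun i : Tor (fine (L ^ m * L ^ k) M) × Fin (d + 1) => blockOf (L ^ m * L ^ k) M i.1)).κ * C₀ * ((((L ^ m : ℕ) : ℝ) - 1) / ((L ^ m * L ^ k : ℕ) : ℝ) * C₀ * Real.exp δ₀ ^ (2 * d + 4) * Real.exp δ₀) *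
        B4Sect5Proof.latticeConst (d + 1) (δ₀ / 2) * Real.exp (-(δ₀ / 2 * tdistT M y y'))) := by
    intro ν
    exact hasMaj_comp_exp (b₂ := (BlockNorm.ofBlocks (unitTorusGeo L k M) (fun i : Tor (fine (L ^ m * L ^ k) M) × Fin (d + 1) => blockOf (L ^ m * L ^ k) M i.1))) (b₃ := (BlockNorm.ofBlocks (unitTorusGeo L k M) (fun i : Tor (fine (L ^ m * L ^ k) M) × Fin (d + 1) => blockOf (L ^ m * L ^ k) M i.1))) (triangle254_unitTorusGeo L k M) (unitTorusGeo_dist_nonneg L k M)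
      (rowSum_unitTorusGeo L k M hσ0) hC₀.le
      (mul_nonneg (mul_nonneg (mul_nonneg (div_nonneg (by linarith) hn'0.le) hC₀.le) (pow_nonneg (Real.exp_nonneg _) _)) (Real.exp_nonneg _))
      hσ0.le (by linarith) (by linarith) (hX ν) (hT ν)
  -- (4) each summand of `G′(P̂₂ − P)ΔG`
  have hpiece : ∀ ν : Fin (d + 1),
      -(gOp M (L ^ m * L ^ k) a ∘ₗ (((symbOp M (L ^ m * L ^ k) (sD M (L ^ m * L ^ k) ν ((L ^ m * L ^ k : ℕ) : ℝ)) * symbOp M (L ^ m * L ^ k) (sH M (L ^ m * L ^ k) (L ^ m) ((L ^ m * L ^ k : ℕ) : ℝ) ν)) ∘ₗ (pull (kingPrV L k m M))) ∘ₗ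
          (symbOp M (L ^ k) (sLap M (L ^ k) ((L ^ k : ℕ) : ℝ)) ∘ₗ gOp M (L ^ k) a)))
        = (gOp M (L ^ m * L ^ k) a ∘ₗ symbOp M (L ^ m * L ^ k) (((L ^ m * L ^ k : ℕ) : ℝ) • (sTinv M (L ^ m * L ^ k) ν - 1))) ∘ₗ
            (symbOp M (L ^ m * L ^ k) (sT M (L ^ m * L ^ k) ν) ∘ₗ (symbOp M (L ^ m * L ^ k) (sH M (L ^ m * L ^ k) (L ^ m) ((L ^ m * L ^ k : ℕ) : ℝ) ν) ∘ₗ ((pull (kingPrV L k m M)) ∘ₗ (symbOp M (L ^ k) (sLap M (L ^ k) ((L ^ k : ℕ) : ℝ)) ∘ₗ gOp M (L ^ k) a)))) := by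
    intro ν
    rw [sD_eq_neg_sTinv_sub_one_mul_sT M (L ^ m * L ^ k) ν ((L ^ m * L ^ k : ℕ) : ℝ), map_neg, map_mul]
    simp only [Module.End.mul_eq_comp, LinearMap.neg_comp, LinearMap.comp_neg, neg_neg, LinearMap.comp_assoc]
  have hsummand : ∀ ν : Fin (d + 1), HasMaj (BlockNorm.ofBlocks (unitTorusGeo L k M) (fun i : Tor (fine (L ^ k) M) × Fin (d + 1) => blockOf (L ^ k) M i.1)) (BlockNorm.ofBlocks (unitTorusGeo L k M) (fun i : Tor (fine (L ^ m * L ^ k) M) × Fin (d + 1) => blockOf (L ^ m * L ^ k) M i.1))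
      (-(gOp M (L ^ m * L ^ k) a ∘ₗ (((symbOp M (L ^ m * L ^ k) (sD M (L ^ m * L ^ k) ν ((L ^ m * L ^ k : ℕ) : ℝ)) * symbOp M (L ^ m * L ^ k) (sH M (L ^ m * L ^ k) (L ^ m) ((L ^ m * L ^ k : ℕ) : ℝ) ν)) ∘ₗ (pull (kingPrV L k m M))) ∘ₗ
          (symbOp M (L ^ k) (sLap M (L ^ k) ((L ^ k : ℕ) : ℝ)) ∘ₗ gOp M (L ^ k) a))))
      (fun y y' => (BlockNorm.ofBlocks (unitTorusGeo L k M) (fun i : Tor (fine (L ^ m * L ^ k) M) × Fin (d + 1) => blockOf (L ^ m * L ^ k) M i.1)).κ * C₀ * ((((L ^ m : ℕ) : ℝ) - 1) / ((L ^ m * L ^ k : ℕ) : ℝ) * C₀ * Real.exp δ₀ ^ (2 * d + 4) * Real.exp δ₀) *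
        B4Sect5Proof.latticeConst (d + 1) (δ₀ / 2) * Real.exp (-(δ₀ / 2 * tdistT M y y'))) := fun ν => by
    rw [hpiece ν]
    exact hcomp ν
  have hsum := hasMaj_finsum (g := (unitTorusGeo L k M)) (b₂ := (BlockNorm.ofBlocks (unitTorusGeo L k M) (fun i : Tor (fine (L ^ m * L ^ k) M) × Fin (d + 1) => blockOf (L ^ m * L ^ k) M i.1))) Finset.univ
    (fun ν => -(gOp M (L ^ m * L ^ k) a ∘ₗ (((symbOp M (L ^ m * L ^ k) (sD M (L ^ m * L ^ k) ν ((L ^ m * L ^ k : ℕ) : ℝ)) * symbOp M (L ^ m * L ^ k) (sH M (L ^ m * L ^ k) (L ^ m) ((L ^ m * L ^ k : ℕ) : ℝ) ν)) ∘ₗ (pull (kingPrV L k m M))) ∘ₗ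
      (symbOp M (L ^ k) (sLap M (L ^ k) ((L ^ k : ℕ) : ℝ)) ∘ₗ gOp M (L ^ k) a))))
    (fun _ y y' => (BlockNorm.ofBlocks (unitTorusGeo L k M) (fun i : Tor (fine (L ^ m * L ^ k) M) × Fin (d + 1) => blockOf (L ^ m * L ^ k) M i.1)).κ * C₀ * ((((L ^ m : ℕ) : ℝ) - 1) / ((L ^ m * L ^ k : ℕ) : ℝ) * C₀ * Real.exp δ₀ ^ (2 * d + 4) * Real.exp δ₀) *
        B4Sect5Proof.latticeConst (d + 1) (δ₀ / 2) * Real.exp (-(δ₀ / 2 * tdistT M y y'))) fun ν _ => hsummand ν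
  have hswapw := fun w => LinearMap.congr_fun hswap w
  refine (hsum.congr fun μ => ?_).mono fun y y' => ?_
  · simp only [LinearMap.sum_apply, LinearMap.comp_apply, LinearMap.neg_apply]
    rw [hswapw]
    simp only [LinearMap.neg_apply, LinearMap.comp_apply, LinearMap.sum_apply, Module.End.mul_apply, map_neg, map_sum,
      Finset.sum_neg_distrib]
  · have hκ : (BlockNorm.ofBlocks (unitTorusGeo L k M) (fun i : Tor (fine (L ^ m * L ^ k) M) × Fin (d + 1) => blockOf (L ^ m * L ^ k) M i.1)).κ = 1 := rfl
    have hE := Real.exp_nonneg (-(δ₀ / 2 * tdistT M y y'))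
    have hrate : (((L ^ m : ℕ) : ℝ) - 1) / ((L ^ m * L ^ k : ℕ) : ℝ) ≤ ((L ^ k : ℕ) : ℝ)⁻¹ := by
      have hR0 : (0 : ℝ) < ((L ^ m : ℕ) : ℝ) := by linarith
      have hn'c : ((L ^ m * L ^ k : ℕ) : ℝ) = ((L ^ m : ℕ) : ℝ) * ((L ^ k : ℕ) : ℝ) := by push_cast; ring
      rw [hn'c, div_le_iff₀ (mul_pos hR0 hn0), show ((L ^ k : ℕ) : ℝ)⁻¹ * (((L ^ m : ℕ) : ℝ) * ((L ^ k : ℕ) : ℝ)) = ((L ^ m : ℕ) : ℝ) by field_simp]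
      linarith
    rw [Finset.sum_const, Finset.card_univ, Fintype.card_fin, nsmul_eq_mul, hκ, Nat.cast_succ]
    have hexp5 : Real.exp δ₀ ^ (2 * d + 4) * Real.exp δ₀ = Real.exp δ₀ ^ (2 * d + 5) := by rw [← pow_succ]
    have hmid : C₀ * ((((L ^ m : ℕ) : ℝ) - 1) / ((L ^ m * L ^ k : ℕ) : ℝ)) * (C₀ * Real.exp δ₀ ^ (2 * d + 5)) * B4Sect5Proof.latticeConst (d + 1) (δ₀ / 2)
        ≤ C₀ * ((L ^ k : ℕ) : ℝ)⁻¹ * (C₀ * Real.exp δ₀ ^ (2 * d + 5)) * B4Sect5Proof.latticeConst (d + 1) (δ₀ / 2) :=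
      mul_le_mul_of_nonneg_right (mul_le_mul_of_nonneg_right (mul_le_mul_of_nonneg_left hrate hC₀.le)
        (mul_nonneg hC₀.le (pow_nonneg (Real.exp_nonneg _) _))) hcR0
    have hd1 : (0 : ℝ) ≤ (d : ℝ) + 1 := by positivity
    calc ((d : ℝ) + 1) * (1 * C₀ * ((((L ^ m : ℕ) : ℝ) - 1) / ((L ^ m * L ^ k : ℕ) : ℝ) * C₀ * Real.exp δ₀ ^ (2 * d + 4) * Real.exp δ₀) *
          B4Sect5Proof.latticeConst (d + 1) (δ₀ / 2) * Real.exp (-(δ₀ / 2 * tdistT M y y')))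
        = ((d : ℝ) + 1) * (C₀ * ((((L ^ m : ℕ) : ℝ) - 1) / ((L ^ m * L ^ k : ℕ) : ℝ)) * (C₀ * Real.exp δ₀ ^ (2 * d + 5)) * B4Sect5Proof.latticeConst (d + 1) (δ₀ / 2)) *
            Real.exp (-(δ₀ / 2 * tdistT M y y')) := by rw [← hexp5]; ring
      _ ≤ ((d : ℝ) + 1) * (C₀ * ((L ^ k : ℕ) : ℝ)⁻¹ * (C₀ * Real.exp δ₀ ^ (2 * d + 5)) * B4Sect5Proof.latticeConst (d + 1) (δ₀ / 2)) *
            Real.exp (-(δ₀ / 2 * tdistT M y y')) := mul_le_mul_of_nonneg_right (mul_le_mul_of_nonneg_left hmid hd1) hE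
      _ = (((d : ℝ) + 1) * (C₀ * (C₀ * Real.exp δ₀ ^ (2 * d + 5)) * B4Sect5Proof.latticeConst (d + 1) (δ₀ / 2))) * ((L ^ k : ℕ) : ℝ)⁻¹ *
            Real.exp (-(δ₀ / 2 * tdistT M y y')) := by ring

/-- ★★ **THE SWAP-ON-THE-LAPLACIAN TERM `G′∘(P̂₂ − P)∘Δ∘G` IS `O(η)` IN BLOCK-MAJORANT CURRENCY, HYPOTHESIS-FREE** (the second Laplacian term of the consistency
operator, plan §7.2 `C_Δu = (Δ′P̂₂ − P̂₂Δ)u + (P̂₂ − P)(Δu)`): `P − P̂₂ = Σ_ν ρ′(sD_ν c′)ρ′(h⁰_ν)∘P` (part 34), `sD_ν c′ = −c′(s_ν⁻¹−1)s_ν`, so each summand is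
`[G′ρ′(c′(s_ν⁻¹−1))]∘[ρ′(s_ν)ρ′(h⁰_ν)∘P∘ΔG]` with (1.110) «G∇*J» (fine member) on the left and «ΔGJ» (coarse member) transported by §29 and part 40's
`hasMaj_sH_comp` (`(L^m−1)/n′ ≤ L^{−k} = η`) on the right; majorant `C·(L^k)⁻¹·e^{−δ|y−y′|_T}`. [cite: Balaban1984PropagatorsI, Prop. 1.2 (1.110) p.35; King1986, Prop. 3.9 p.664 (η-rate shape)] -/
theorem hasMaj_swapLapDefect (hL : Odd L ∧ 1 < L) {a : ℝ} (ha : 0 < a) :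
    ∃ δ C : ℝ, 0 < δ ∧ 0 < C ∧ ∀ (mT k m : ℕ) (hk : 1 ≤ k),
      HasMaj (BlockNorm.ofBlocks (unitTorusGeo L k (MP (paramsOf d L mT k hL)))
          (fun i : Tor (fine (L ^ k) (MP (paramsOf d L mT k hL))) × Fin (d + 1) => blockOf (L ^ k) (MP (paramsOf d L mT k hL)) i.1))
        (BlockNorm.ofBlocks (unitTorusGeo L k (MP (paramsOf d L mT k hL)))
          (fun i : Tor (fine (L ^ m * L ^ k) (MP (paramsOf d L mT k hL))) × Fin (d + 1) => blockOf (L ^ m * L ^ k) (MP (paramsOf d L mT k hL)) i.1))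
        (gOp (MP (paramsOf d L mT k hL)) (L ^ m * L ^ k) a ∘ₗ
          ((symbOp (MP (paramsOf d L mT k hL)) (L ^ m * L ^ k) (sSm (MP (paramsOf d L mT k hL)) (L ^ m * L ^ k) (L ^ m)) ∘ₗ
              pull (kingPrV L k m (MP (paramsOf d L mT k hL))) - pull (kingPrV L k m (MP (paramsOf d L mT k hL)))) ∘ₗ
            (symbOp (MP (paramsOf d L mT k hL)) (L ^ k) (sLap (MP (paramsOf d L mT k hL)) (L ^ k) ((L ^ k : ℕ) : ℝ)) ∘ₗ
              gOp (MP (paramsOf d L mT k hL)) (L ^ k) a)))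
        (fun y y' => C * ((L ^ k : ℕ) : ℝ)⁻¹ * Real.exp (-(δ * tdistT (MP (paramsOf d L mT k hL)) y y'))) := by
  obtain ⟨δ₀, C₀, Cα, Cε, Cαε, hδ₀, hC₀, HP⟩ := ineq110_114_pair (d := d) hL ha
  have hcR0 : 0 ≤ B4Sect5Proof.latticeConst (d + 1) (δ₀ / 2) := B4Sect5Proof.latticeConst_nonneg (d + 1) (by linarith)
  refine ⟨δ₀ / 2, ((d : ℝ) + 1) * (C₀ * (C₀ * Real.exp δ₀ ^ (2 * d + 5)) * B4Sect5Proof.latticeConst (d + 1) (δ₀ / 2)) + 1, by linarith, by positivity,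
    fun mT k m hk => ?_⟩
  refine (hasMaj_swapLapDefect_core (MP (paramsOf d L mT k hL)) k m a hC₀ hδ₀ (HP mT k m hk).1 (HP mT k m hk).2).mono fun y y' => ?_
  have hn0 : (0 : ℝ) < ((L ^ k : ℕ) : ℝ) := by exact_mod_cast Nat.one_le_pow _ _ (Nat.pos_of_ne_zero (NeZero.ne L))
  exact mul_le_mul_of_nonneg_right (mul_le_mul_of_nonneg_right (by linarith) (inv_nonneg.mpr hn0.le)) (Real.exp_nonneg _)

end LapDefect

end Summit.QuantumFields.YangMills.BalabanUVNodes.N15.TwoGrid
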